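import Mathlib
import Summits.NavierStokesRegularity.NavierStokesRegularity.Theorems.ScenarioCensusPeriodicSlabLiouville
import Literature.Analysis.FluidPDE.SteadyHelicalLiouville
import HarnessLib

/-!
# Census rows S6 / S7: the small period–Reynolds number case of the helical steady Liouville theorem

Support file for the scenario census of `NavierStokesRegularity` (cell `pub/ns-census`, block S). Row
S6 is the printed Liouville theorem of Han–Wang–Xie (arXiv:2312.10382 = Sci. China Math. 2025,
Thm 1.1; tree FACT `Literature.Analysis.FluidPDE.HanWangXie2023_helical_liouville`, no `_holds`):
a bounded smooth helically symmetric steady flow on `ℝ³` is an axial constant `C e₃`. A helically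
symmetric field of pitch `κ ≠ 0` is `2π|κ|`-periodic along the axis ("Hence any helically symmetric
flow is periodic in `x₃`-direction, with a period `2π|κ|`", loc. cit. §1), so the tree theorem
`PeriodicSlab.periodicSlab_liouville_small` (Bang–Gui–Wang–Xie 2025 Thm 1.4 (d), row S7d) settles the
SMALL period–Reynolds sub-cell of S6 unconditionally:

* `isAxiallyPeriodic_of_isHelicallySymmetric` — pitch `κ` ⇒ axial period `2πκ` (`isAxiallyPeriodic_neg`: and `−2πκ`);
* `helical_liouville_small` — `ν > 0`, `κ ≠ 0`, `IsLerayProfile ν 0 U P`, `U, P ∈ C^∞`,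
  `sup ‖U‖ < ν/|κ|` (`= 2πν/(2π|κ|)`), `IsHelicallySymmetric κ U` ⇒ `U ≡ C e₃` — the conclusion of
  the S6 fact on the sub-class `Re_P = 2π|κ|·sup‖U‖/ν < 2π`, with the same binders plus the bound.

No summit statement and no census row is proved in this file; S6 proper (any `Re_P`) stays PRINT.

## References

* J. Han, Y. Wang, C. Xie, arXiv:2312.10382 (2023), Thm 1.1 and §1 (periodicity of helical fields).
  [HanWangXie2023]
* J. Bang, C. Gui, Y. Wang, C. Xie, J. Fluid Mech. 1005 (2025) A6 = arXiv:2205.13259, Thm 1.4 (d).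
  [BangGuiWangXie2025]
-/

-- the summit and its single problem share the name (D-0017 nested layout)
set_option linter.dupNamespace false

noncomputable section

open MeasureTheory Set Function Filter
open scoped Topology RealInnerProductSpace

namespace Summit.NavierStokesRegularity.NavierStokesRegularity.Theorems.ScenarioCensus.PeriodicSlab

open Literature.Analysis Literature.Analysis.FluidPDE

/-- **A helically symmetric field of pitch `κ` is axially periodic with period `2πκ`** (the screw
motion by the angle `2π` is the translation by `2πκ e₃`). -/
theorem isAxiallyPeriodic_of_isHelicallySymmetric {κ : ℝ}
    {U : EuclideanSpace ℝ (Fin 3) → EuclideanSpace ℝ (Fin 3)} (hU : IsHelicallySymmetric κ U) :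
    IsAxiallyPeriodic (2 * Real.pi * κ) U := by
  intro x
  -- the full turn is the identity (cf. the tree's `rotZ_two_pi` lemmas; inlined to stay import-light)
  have hturn : ∀ y : EuclideanSpace ℝ (Fin 3), rotZ (2 * Real.pi) y = y := fun y => by
    ext i
    fin_cases i <;> simp [rotZ, Real.cos_two_pi, Real.sin_two_pi]
  have h := hU (2 * Real.pi) x
  rw [hturn, hturn] at h
  have e : (κ * (2 * Real.pi)) • (eZ : EuclideanSpace ℝ (Fin 3)) =
      (2 * Real.pi * κ) • EuclideanSpace.single 2 (1 : ℝ) := by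
    rw [mul_comm]; rfl
  rw [e] at h
  exact h

/-- Axial periodicity with period `p` implies axial periodicity with period `−p`. -/
theorem isAxiallyPeriodic_neg {α : Sort*} {p : ℝ} {U : EuclideanSpace ℝ (Fin 3) → α}
    (hU : IsAxiallyPeriodic p U) : IsAxiallyPeriodic (-p) U := by
  intro x
  have h := hU (x + (-p) • EuclideanSpace.single 2 (1 : ℝ))
  rw [add_assoc, ← add_smul, neg_add_cancel, zero_smul, add_zero] at h
  exact h.symm

/-- **The small period–Reynolds number case of the helical steady Liouville theorem (row S6),
proved.** For `ν > 0`, `κ ≠ 0`, a smooth steady solution `(U, P)` of unforced Navier–Stokes on `ℝ³`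
(`IsLerayProfile ν 0 U P`, `U, P ∈ C^∞`), helically symmetric with pitch `κ`
(`IsHelicallySymmetric κ U`) and bounded with `sup ‖U‖ < ν/|κ|` (i.e. period–Reynolds number
`2π|κ|·sup‖U‖/ν < 2π`), is an axial constant `U ≡ C e₃`. Proof: the field is `2π|κ|`-periodic along
the axis, so `periodicSlab_liouville_small` (Bang–Gui–Wang–Xie Thm 1.4 (d)) makes it constant, and a
helically symmetric constant is axial (half turn `ρ = π`). -/
theorem helical_liouville_small {ν κ : ℝ} (hν : 0 < ν) (hκ : κ ≠ 0)
    {U : EuclideanSpace ℝ (Fin 3) → EuclideanSpace ℝ (Fin 3)} {P : EuclideanSpace ℝ (Fin 3) → ℝ}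
    (hprof : IsLerayProfile ν 0 U P) (hU : ContDiff ℝ (⊤ : ℕ∞) U) (hP : ContDiff ℝ (⊤ : ℕ∞) P)
    (hbd : ∃ M : ℝ, M < ν / |κ| ∧ ∀ x, ‖U x‖ ≤ M) (hsym : IsHelicallySymmetric κ U) :
    ∃ C : ℝ, U = fun _ => C • eZ := by
  obtain ⟨M, hMlt, hM⟩ := hbd
  -- axial period `L = 2π|κ|`
  set L : ℝ := 2 * Real.pi * |κ| with hL
  have hL0 : 0 < L := by rw [hL]; positivity
  have hper : IsAxiallyPeriodic L U := by
    have h1 := isAxiallyPeriodic_of_isHelicallySymmetric hsym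
    rcases le_or_gt 0 κ with hk | hk
    · rw [hL, abs_of_nonneg hk]; exact h1
    · rw [hL, abs_of_neg hk, show 2 * Real.pi * -κ = -(2 * Real.pi * κ) by ring]
      exact isAxiallyPeriodic_neg h1
  have hsmall : ∃ M : ℝ, M < 2 * Real.pi * ν / L ∧ ∀ x, ‖U x‖ ≤ M := by
    refine ⟨M, ?_, hM⟩
    have habs : 0 < |κ| := abs_pos.2 hκ
    rw [hL, show 2 * Real.pi * ν / (2 * Real.pi * |κ|) = ν / |κ| by
      field_simp]
    exact hMlt
  obtain ⟨C, hC⟩ := periodicSlab_liouville_small hν hL0 hprof hU hP hsmall hper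
  -- a helically symmetric constant field is axial
  have hrot : rotZ Real.pi C = C := by
    have h := hsym Real.pi 0
    rw [hC] at h
    exact h.symm
  have hC0 : C 0 = 0 := by
    have h0 := congrArg (fun v : EuclideanSpace ℝ (Fin 3) => v 0) hrot
    simp only [rotZ_apply_zero, Real.cos_pi, Real.sin_pi] at h0
    linarith
  have hC1 : C 1 = 0 := by
    have h1 := congrArg (fun v : EuclideanSpace ℝ (Fin 3) => v 1) hrot
    simp only [rotZ_apply_one, Real.cos_pi, Real.sin_pi] at h1
    linarith
  refine ⟨C 2, ?_⟩
  rw [hC]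
  funext x
  ext i
  fin_cases i <;> simp [eZ, hC0, hC1]

end Summit.NavierStokesRegularity.NavierStokesRegularity.Theorems.ScenarioCensus.PeriodicSlab

end
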